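import Summits.BirchSwinnertonDyer.BirchSwinnertonDyer.Theses.ByReductionTypeAtTwo
import HarnessLib

/-!
# Crux `OrdKatoHalfAtTwoIso` (stmt-BirchSwinnertonDyer-19573), line `steinberg-fibre-at-two` — P7 RESTATE CERTIFICATE, PART A
# (HEADER-ONLY): the two proposed sign-free child texts ELABORATE IN THE ROUTE FILE'S CONTEXT (this module imports only
# `Theses.ByReductionTypeAtTwo`; no new import is needed by the route file). Lead g5, pen RC-366.

Nothing asserted; `sorry`-free; definitions of two `Prop` texts only. Part B (`…_restate_P7_signfree.lean`) proves them
`Iff.rfl` to the Theorems constants `SteinbergFibreAtTwo.ZetaColemanMuInputsAtTwo` / `SteinbergFibreAtTwo.CoreTheoremAPosDiscTwo`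
(`…OrdKatoHalfAtTwoIsoSignFreeDefs.lean`) and closes the post-P7 split glue by name. BSD is not proved; the crux and its
children stay OPEN.
-/

set_option linter.dupNamespace false

namespace Summit.BirchSwinnertonDyer.BirchSwinnertonDyer.Cruxes.OrdKatoHalfAtTwoIso.SteinbergFibreAtTwo.RestateP7

/-- PROPOSED TEXT T_F1μ⁺ for the F1 slot (child 23890 `OrdKatoFineZetaAtTwoResidue` ↦ sign-free): the rev-33 text with the
binder `W.Δ < 0 →` deleted; route vocabulary, fully qualified, doubly unfolded. [folklore] -/
def OrdKatoFineZetaAtTwoSignFreeText : Prop :=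
  ∀ (W : WeierstrassCurve ℚ) [W.IsElliptic] [W.IsGloballyMinimal] [ContinuousSMul (PadicInt 2) (W.tateModule 2)] [Module.Free (PadicInt 2) (W.tateModule 2)] [Module.Finite (PadicInt 2) (W.tateModule 2)] {N : ℕ} [NeZero N] (f : CuspForm (Subgroup.map (Matrix.SpecialLinearGroup.mapGL ℝ) (CongruenceSubgroup.Gamma0 N)) 2) (κ : Literature.NumberTheory.EllipticCurves.ZpExtension ℚ 2) (γ : Field.absoluteGaloisGroup ℚ) (hκ : κ.IsCyclotomic), Literature.NumberTheory.EllipticCurves.IsOrdinaryAt W 2 → W.HasSurjectiveModNGaloisRep 2 → κ.IsTopGenerator γ → Literature.NumberTheory.EllipticCurves.IsCyclotomicVariable 2 γ → Literature.NumberTheory.EllipticCurves.ModularForms.IsNewformOf W f → ∀ (D : W.SelmerDualData κ γ) (Y : W.FineSelmerDualData κ γ), ∃ (I : Literature.NumberTheory.EllipticCurves.Kato2004.IwasawaH1Data W 2 κ γ) (Z : Submodule (Literature.NumberTheory.EllipticCurves.IwasawaAlgebra 2) I.H) (P : Submodule (Literature.NumberTheory.EllipticCurves.IwasawaAlgebra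 2) (Literature.NumberTheory.EllipticCurves.IwasawaAlgebra 2)) (ℓ : I.H →ₗ[Literature.NumberTheory.EllipticCurves.IwasawaAlgebra 2] P) (τ : P →ₗ[Literature.NumberTheory.EllipticCurves.IwasawaAlgebra 2] D.X) (π : D.X →ₗ[Literature.NumberTheory.EllipticCurves.IwasawaAlgebra 2] Y.X), Z ≤ Submodule.span (Literature.NumberTheory.EllipticCurves.IwasawaAlgebra 2) {s : I.H | Literature.NumberTheory.EllipticCurves.Kato2004.IsEulerSystemClassTwo W hκ I s} ∧ (∀ z ∈ Z, τ (ℓ z) = 0) ∧ Function.Surjective π ∧ Function.Exact τ π ∧ ∀ G₁ : Literature.NumberTheory.EllipticCurves.IwasawaAlgebra 2, Literature.NumberTheory.EllipticCurves.iwasawaToPowerSeries 2 G₁ = Literature.NumberTheory.EllipticCurves.padicLFunction f (Literature.NumberTheory.EllipticCurves.unitRoot W 2 : ℚ_[2]) → ∃ s : Literature.NumberTheory.EllipticCurves.IwasawaAlgebra 2, s ∉ Literature.NumberTheory.EllipticCurves.IwasawaAlgebra.augIdealP 2 ∧ s * G₁ ∈ Submodule.map (P.subtype ∘ₗ ℓ)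 Z

/-- PROPOSED TEXT T_core⁺ for the B8 slot (child 23762 `OrdKatoIntSurjectiveAtTwo` ↦ the core Theorem A at `2` on
`0 < Δ`, the real place): the body of `SteinbergFibreAtTwo.CoreTheoremATwoResidue` (p655368) with `W.Δ < 0` replaced by
`0 < W.Δ`; route vocabulary, fully qualified. [folklore] -/
def OrdKatoCoreRealPlaceAtTwoText : Prop :=
  ∀ (W : WeierstrassCurve ℚ) [W.IsElliptic] [W.IsGloballyMinimal] [ContinuousSMul (PadicInt 2) (W.tateModule 2)] [Module.Free (PadicInt 2) (W.tateModule 2)] [Module.Finite (PadicInt 2) (W.tateModule 2)] (κ : Literature.NumberTheory.EllipticCurves.ZpExtension ℚ 2) (γ : Field.absoluteGaloisGroup ℚ) (I : Literature.NumberTheory.EllipticCurves.Kato2004.IwasawaH1Data W 2 κ γ) (hκ : κ.IsCyclotomic), W.HasGoodReductionAtPrime 2 → ¬ (2 : ℤ) ∣ W.frobeniusTrace 2 → W.HasSurjectiveModNGaloisRep 2 → 0 < W.Δ → κ.IsTopGenerator γ → (∃ s : I.H, Literature.NumberTheory.EllipticCurves.Kato2004.IsEulerSystemClassTwo W hκ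 I s ∧ s ∉ Literature.NumberTheory.EllipticCurves.IwasawaAlgebra.augIdealP 2 • (⊤ : Submodule (Literature.NumberTheory.EllipticCurves.IwasawaAlgebra 2) I.H)) → ∃ J : ℕ, ∀ y : Literature.NumberTheory.EllipticCurves.subgroupH1 κ.kerSubgroup (WeierstrassCurve.geomTorsion W (2 : ℤ)), W.torsionToPrimaryH1Sub 2 κ.kerSubgroup y ∈ W.fineSelmerInfty κ → (⇑(Literature.NumberTheory.EllipticCurves.conjH1 κ.kerSubgroup (WeierstrassCurve.geomTorsion W (2 : ℤ)) γ - AddMonoidHom.id (Literature.NumberTheory.EllipticCurves.subgroupH1 κ.kerSubgroup (WeierstrassCurve.geomTorsion W (2 : ℤ)))))^[J] y = 0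

end Summit.BirchSwinnertonDyer.BirchSwinnertonDyer.Cruxes.OrdKatoHalfAtTwoIso.SteinbergFibreAtTwo.RestateP7
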